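import Summits.QuantumFields.YangMills.Theorems.SwapVirialDeficitZeroModeGroupFourSmallBallDecayFibre
import HarnessLib

/-!
# Exact zero-mode rung, FOUR pairwise nearly commuting letters — VIII-c: UNIFORM DECAY `vol³(T(η, ζ, κ)) ≤ C·κ^{-1/4}`
# (zero-mode block of crux ⟨stmt-QuantumFields-24497⟩ `ToronTubeVolumeLaw`; free-hands support of ⟨stmt-QuantumFields-24197⟩ / ⟨24497⟩)

★★★ `volume_twoScaleSet4_le_decay` : there is a finite constant `C` with `vol³(T(η, ζ, κ)) ≤ C·(κ^{1/4})⁻¹` for ALL `η, ζ ≥ 0`, `κ > 0`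
(`κ^{1/4}` written `√(√κ)`).  In the radial formula of part VII (`κ = t²(a₀²+ρ²)²/(4ρ⁴)`) this is `≲ ρ/√t`: integrable against `dρ/ρ` on
`ρ ≲ √t` uniformly in `t` — the lower cut-off of the logarithm and the deep region in one estimate.  Mechanism: over the reference letter `x`
(largest transverse size `ρ_x`) each other letter lies in the cut fibre `fibreK κ x` of part VIII-a, of volume `v ≤ 16√2·m`, `m = min(ρ_x, 1/|x_I|)`,
AND `v ≤ 16√2/(ρ_x√κ)`; hence `v² ≤ a√(ab) = 512·m√m/(√ρ_x·κ^{1/4})` (VIII-b §29), and `∫ m√m dx_I = C₁√ρ_x` EXACTLY by scaling (VIII-b §28,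
`C₁ = ∫ n√n`, `n = min(1, 1/|u|)`, finite by comparison with `(1 + |u|)^{-3/2}`), so `√ρ_x` cancels and the `x`-integral is bounded (§30).
HONEST LABEL: finite-dimensional measure theory on `SU(2)⁴` (plan-level zero-mode rung of DRAFT lines); NOT ⟨24497⟩, NOT ⟨24197⟩; the Yang–Mills mass gap
is NOT proved; no summit is proved by a line.  Seat ym-line-fcl-p3 g44 (cell ym-idea-1, free hands), `--supports stmt-QuantumFields-24197`.  Standard axioms
(auxiliary defs `Phi`, `HcoordK`, `decayConst`).  References: [cite: GonzalezarroyoAltes1988]; [cite: Vanbaal2001]; [folklore].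
-/

set_option autoImplicit false

noncomputable section

open MeasureTheory Quaternion Set Real
open scoped Quaternion ENNReal BigOperators
open Literature.MathematicalPhysics.QuantumLattice
open Summit.QuantumFields.YangMills.Theorems.SwapTwistDeficit.ToronLog

attribute [local instance] Literature.Analysis.FluidPDE.Tao2016.quatMeasurableSpace
  Literature.Analysis.FluidPDE.Tao2016.quatBorelSpace
  Literature.MathematicalPhysics.QuantumLattice.secondCountableTopology_su2

namespace Summit.QuantumFields.YangMills.Theorems.SwapVirialDeficit.ZeroModeGroup

/-! ## §30 Assembly -/

/-- The measurable squared-fibre bound `Φ_κ(ξ, ρ²)` (`0` on the degenerate slice `ρ² ≤ 0`). [folklore] -/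
def Phi (κ ξ ρ2 : ℝ) : ℝ≥0∞ :=
  if ρ2 ≤ 0 then 0 else ENNReal.ofReal (512 * (mfun ξ (Real.sqrt ρ2) * Real.sqrt (mfun ξ (Real.sqrt ρ2))) / (Real.sqrt (Real.sqrt ρ2) * Real.sqrt (Real.sqrt κ)))

/-- `Φ_κ` is jointly measurable. [folklore] -/
theorem measurable_Phi (κ : ℝ) : Measurable fun p : ℝ × ℝ => Phi κ p.1 p.2 := by
  unfold Phi
  have hm : Measurable fun p : ℝ × ℝ => mfun p.1 (Real.sqrt p.2) := measurable_mfun.comp (measurable_fst.prodMk (Real.continuous_sqrt.measurable.comp measurable_snd))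
  refine Measurable.ite (measurableSet_le measurable_snd measurable_const) measurable_const ?_
  exact ENNReal.measurable_ofReal.comp (((hm.mul (Real.continuous_sqrt.measurable.comp hm)).const_mul _).div
    ((Real.continuous_sqrt.measurable.comp (Real.continuous_sqrt.measurable.comp measurable_snd)).mul measurable_const))

/-- `vol(fibreK κ x)² ≤ Φ_κ(x_I, tvSq x)`. [folklore] -/
theorem volume_fibreK_sq_le_Phi {κ : ℝ} (hκ : 0 < κ) (x : ℍ) : volume (fibreK κ x) * volume (fibreK κ x) ≤ Phi κ x.imI (tvSq x) := by
  unfold Phi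
  split_ifs with h
  · have h0 : tvSq x = 0 := le_antisymm h (tvSq_nonneg x)
    have hz : volume (fibreK κ x) = 0 := measure_mono_null (fibreK_subset_fibre4 κ x) (volume_fibre4_eq_zero h0)
    rw [hz, mul_zero]
  · exact volume_fibreK_sq_le hκ (not_le.1 h)

/-- ★ `∫ Φ_κ(ξ, ρ²) dξ ≤ 512·C₁/κ^{1/4}` for `ρ² ≥ 0` — the `√ρ` of §28 cancels the `1/√ρ` of §29. [folklore] -/
theorem lintegral_Phi_le {κ : ℝ} (hκ : 0 < κ) (ρ2 : ℝ) :
    ∫⁻ ξ : ℝ, Phi κ ξ ρ2 ≤ ENNReal.ofReal (512 / Real.sqrt (Real.sqrt κ)) * C1 := by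
  unfold Phi
  split_ifs with h
  · rw [lintegral_zero]; exact zero_le
  · have hρ2 : 0 < ρ2 := not_le.1 h
    set ρ := Real.sqrt ρ2 with hρ
    have hρpos : 0 < ρ := Real.sqrt_pos.2 hρ2
    have hsρ : 0 < Real.sqrt ρ := Real.sqrt_pos.2 hρpos
    have hsk : 0 < Real.sqrt (Real.sqrt κ) := Real.sqrt_pos.2 (Real.sqrt_pos.2 hκ)
    have e : ∀ ξ : ℝ, ENNReal.ofReal (512 * (mfun ξ ρ * Real.sqrt (mfun ξ ρ)) / (Real.sqrt ρ * Real.sqrt (Real.sqrt κ))) =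
        ENNReal.ofReal (512 / (Real.sqrt ρ * Real.sqrt (Real.sqrt κ))) * ENNReal.ofReal (mfun ξ ρ * Real.sqrt (mfun ξ ρ)) := by
      intro ξ
      rw [← ENNReal.ofReal_mul (by positivity)]
      congr 1; field_simp
    simp_rw [e]
    rw [lintegral_const_mul' _ _ ENNReal.ofReal_ne_top, lintegral_mfun_sqrt hρpos, ← mul_assoc, ← ENNReal.ofReal_mul (by positivity)]
    gcongr
    apply le_of_eq
    field_simp

/-- `vol³(domRefK κ) ≤ ∫ 𝟙_{okRef}·vol(fibreK κ x)²` (sections over `(x, y)` lie in `fibreK κ x`, and `y` ranges over `fibreK κ x`). [folklore] -/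
theorem volume_domRefK_le_lintegral (κ : ℝ) :
    (((volume : Measure ℍ).prod (volume : Measure ℍ)).prod (volume : Measure ℍ)) (domRefK κ) ≤
      ∫⁻ x, okRef.indicator (fun x => volume (fibreK κ x) * volume (fibreK κ x)) x := by
  rw [Measure.prod_apply (measurableSet_domRefK κ)]
  have hFx : Measurable fun x : ℍ => volume (fibreK κ x) := measurable_measure_prodMk_left (measurableSet_fibreK_joint κ)
  set F : ℍ × ℍ → ℝ≥0∞ := fun q => okRef.indicator (fun _ => (1 : ℝ≥0∞)) q.1 * (volume (fibreK κ q.1) * {q' : ℍ × ℍ | q'.2 ∈ fibreK κ q'.1}.indicator 1 q)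
    with hF
  have hFm : Measurable F :=
    ((measurable_const.indicator measurableSet_okRef).comp measurable_fst).mul
      ((hFx.comp measurable_fst).mul (measurable_const.indicator (measurableSet_fibreK_joint κ)))
  have hsec : ∀ q : ℍ × ℍ, (volume : Measure ℍ) (Prod.mk q ⁻¹' domRefK κ) ≤ F q := by
    rintro ⟨x, y⟩
    by_cases hne : (Prod.mk (x, y) ⁻¹' domRefK κ).Nonempty
    · obtain ⟨z0, hz0⟩ := hne
      obtain ⟨hx, hy, -⟩ := section_domRefK hz0
      have hsub : Prod.mk (x, y) ⁻¹' domRefK κ ⊆ fibreK κ x := fun z hz => (section_domRefK hz).2.2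
      have e : F (x, y) = volume (fibreK κ x) := by
        simp only [hF, Set.indicator_of_mem hx, Set.indicator_of_mem (show (x, y) ∈ {q' : ℍ × ℍ | q'.2 ∈ fibreK κ q'.1} from hy),
          Pi.one_apply, one_mul, mul_one]
      rw [e]; exact measure_mono hsub
    · rw [Set.not_nonempty_iff_eq_empty.1 hne, measure_empty]; exact zero_le
  calc ∫⁻ q, (volume : Measure ℍ) (Prod.mk q ⁻¹' domRefK κ) ∂((volume : Measure ℍ).prod (volume : Measure ℍ))
      ≤ ∫⁻ q, F q ∂((volume : Measure ℍ).prod (volume : Measure ℍ)) := lintegral_mono hsec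
    _ = ∫⁻ x, ∫⁻ y, F (x, y) := lintegral_prod F hFm.aemeasurable
    _ = ∫⁻ x, okRef.indicator (fun _ => (1 : ℝ≥0∞)) x * (volume (fibreK κ x) * volume (fibreK κ x)) := by
        refine lintegral_congr fun x => ?_
        have hm2 : Measurable fun y : ℍ => ({q' : ℍ × ℍ | q'.2 ∈ fibreK κ q'.1} : Set (ℍ × ℍ)).indicator (1 : ℍ × ℍ → ℝ≥0∞) (x, y) :=
          (measurable_const.indicator (measurableSet_fibreK_joint κ)).comp measurable_prodMk_left
        have hm : Measurable fun y : ℍ => volume (fibreK κ x) * {q' : ℍ × ℍ | q'.2 ∈ fibreK κ q'.1}.indicator 1 (x, y) := measurable_const.mul hm2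
        simp only [hF]
        rw [lintegral_const_mul _ hm, lintegral_const_mul _ hm2]
        congr 2
        have e : (fun y : ℍ => ({q' : ℍ × ℍ | q'.2 ∈ fibreK κ q'.1} : Set (ℍ × ℍ)).indicator (1 : ℍ × ℍ → ℝ≥0∞) (x, y)) = (fibreK κ x).indicator 1 := by
          funext y
          by_cases hy : y ∈ fibreK κ x
          · rw [Set.indicator_of_mem (show (x, y) ∈ {q' : ℍ × ℍ | q'.2 ∈ fibreK κ q'.1} from hy), Set.indicator_of_mem hy]; rfl
          · rw [Set.indicator_of_notMem (show (x, y) ∉ {q' : ℍ × ℍ | q'.2 ∈ fibreK κ q'.1} from hy), Set.indicator_of_notMem hy]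
        rw [e, lintegral_indicator_one (measurableSet_fibreK κ x)]
    _ = ∫⁻ x, okRef.indicator (fun x => volume (fibreK κ x) * volume (fibreK κ x)) x := by
        refine lintegral_congr fun x => ?_
        by_cases hx : x ∈ okRef
        · rw [Set.indicator_of_mem hx, Set.indicator_of_mem hx, one_mul]
        · rw [Set.indicator_of_notMem hx, Set.indicator_of_notMem hx, zero_mul]

/-- The integrand in coordinates: `𝟙{r² < 1}·𝟙{J² + K² ≤ 1}·Φ_κ(ξ, J² + K²)`. [folklore] -/
def HcoordK (κ : ℝ) (p : ℝ × (ℝ × (ℝ × ℝ))) : ℝ≥0∞ :=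
  {r : ℝ | r ^ 2 < 1}.indicator 1 p.1 * ({q : ℝ × ℝ | q.1 ^ 2 + q.2 ^ 2 ≤ 1}.indicator 1 p.2.2 * Phi κ p.2.1 (p.2.2.1 ^ 2 + p.2.2.2 ^ 2))

/-- The inner coordinate integrand is measurable. [folklore] -/
theorem measurable_HinnerK (κ : ℝ) :
    Measurable fun q : ℝ × (ℝ × ℝ) => {q : ℝ × ℝ | q.1 ^ 2 + q.2 ^ 2 ≤ 1}.indicator 1 q.2 * Phi κ q.1 (q.2.1 ^ 2 + q.2.2 ^ 2) :=
  ((measurable_const.indicator measurableSet_disc).comp measurable_snd).mul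
    ((measurable_Phi κ).comp (measurable_fst.prodMk (((measurable_fst.comp measurable_snd).pow_const 2).add ((measurable_snd.comp measurable_snd).pow_const 2))))

/-- `HcoordK κ` is measurable. [folklore] -/
theorem measurable_HcoordK (κ : ℝ) : Measurable (HcoordK κ) :=
  ((measurable_const.indicator (measurableSet_lt (measurable_id.pow_const 2) measurable_const)).comp measurable_fst).mul
    ((measurable_HinnerK κ).comp measurable_snd)

/-- `𝟙_{okRef}·Φ_κ(x_I, tvSq x) = HcoordK κ ∘ coord4`. [folklore] -/
theorem indicator_Phi_eq_HcoordK (κ : ℝ) (x : ℍ) : okRef.indicator (fun x => Phi κ x.imI (tvSq x)) x = HcoordK κ (coord4 x) := by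
  have htv : tvSq x = x.imJ ^ 2 + x.imK ^ 2 := rfl
  simp only [HcoordK, coord4]
  by_cases hx : x ∈ okRef
  · rw [Set.indicator_of_mem hx, Set.indicator_of_mem (show x.re ∈ {r : ℝ | r ^ 2 < 1} from hx.1),
      Set.indicator_of_mem (show (x.imJ, x.imK) ∈ {q : ℝ × ℝ | q.1 ^ 2 + q.2 ^ 2 ≤ 1} from by simpa [htv] using hx.2),
      Pi.one_apply, Pi.one_apply, one_mul, one_mul, htv]
  · rw [Set.indicator_of_notMem hx]
    by_cases hr : x.re ^ 2 < 1
    · have htv1 : ¬ tvSq x ≤ 1 := fun h => hx ⟨hr, h⟩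
      rw [Set.indicator_of_notMem (show (x.imJ, x.imK) ∉ {q : ℝ × ℝ | q.1 ^ 2 + q.2 ^ 2 ≤ 1} from by simpa [htv] using htv1), zero_mul, mul_zero]
    · rw [Set.indicator_of_notMem (show x.re ∉ {r : ℝ | r ^ 2 < 1} from hr), zero_mul]

/-- The inner coordinate integral: `∫∫ 𝟙_{disc}·Φ_κ ≤ 4·(512·C₁/κ^{1/4})`. [folklore] -/
theorem lintegral_HinnerK_le {κ : ℝ} (hκ : 0 < κ) :
    ∫⁻ q : ℝ × (ℝ × ℝ), {q : ℝ × ℝ | q.1 ^ 2 + q.2 ^ 2 ≤ 1}.indicator 1 q.2 * Phi κ q.1 (q.2.1 ^ 2 + q.2.2 ^ 2) ≤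
      ENNReal.ofReal 4 * (ENNReal.ofReal (512 / Real.sqrt (Real.sqrt κ)) * C1) := by
  rw [Measure.volume_eq_prod, lintegral_prod_symm _ (measurable_HinnerK κ).aemeasurable]
  have hinner : ∀ JK : ℝ × ℝ, ∫⁻ ξ : ℝ, {q : ℝ × ℝ | q.1 ^ 2 + q.2 ^ 2 ≤ 1}.indicator 1 JK * Phi κ ξ (JK.1 ^ 2 + JK.2 ^ 2) ≤
      (Icc (-1 : ℝ) 1 ×ˢ Icc (-1 : ℝ) 1).indicator (fun _ => ENNReal.ofReal (512 / Real.sqrt (Real.sqrt κ)) * C1) JK := by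
    intro JK
    by_cases hJK : JK ∈ {q : ℝ × ℝ | q.1 ^ 2 + q.2 ^ 2 ≤ 1}
    · have h1 : JK.1 ^ 2 ≤ 1 := by have := hJK; simp only [Set.mem_setOf_eq] at this; nlinarith [sq_nonneg JK.2]
      have h2 : JK.2 ^ 2 ≤ 1 := by have := hJK; simp only [Set.mem_setOf_eq] at this; nlinarith [sq_nonneg JK.1]
      have hbox : JK ∈ Icc (-1 : ℝ) 1 ×ˢ Icc (-1 : ℝ) 1 := by
        have a1 := mem_Icc_of_sq_le h1; have a2 := mem_Icc_of_sq_le h2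
        rw [Real.sqrt_one] at a1 a2
        exact ⟨a1, a2⟩
      rw [Set.indicator_of_mem hbox]
      simp only [Set.indicator_of_mem hJK, Pi.one_apply, one_mul]
      exact lintegral_Phi_le hκ _
    · simp only [Set.indicator_of_notMem hJK, zero_mul, lintegral_zero]; exact zero_le
  calc _ ≤ ∫⁻ JK : ℝ × ℝ, (Icc (-1 : ℝ) 1 ×ˢ Icc (-1 : ℝ) 1).indicator (fun _ => ENNReal.ofReal (512 / Real.sqrt (Real.sqrt κ)) * C1) JK :=
        lintegral_mono hinner
    _ = (ENNReal.ofReal (512 / Real.sqrt (Real.sqrt κ)) * C1) * volume (Icc (-1 : ℝ) 1 ×ˢ Icc (-1 : ℝ) 1) := by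
        rw [lintegral_indicator (measurableSet_Icc.prod measurableSet_Icc), setLIntegral_const]
    _ = ENNReal.ofReal 4 * (ENNReal.ofReal (512 / Real.sqrt (Real.sqrt κ)) * C1) := by
        rw [Measure.volume_eq_prod, Measure.prod_prod, Real.volume_Icc, ← ENNReal.ofReal_mul (by norm_num), mul_comm]; norm_num

/-- `∫ 𝟙_{okRef}·Φ_κ ≤ 2·4·512·C₁/κ^{1/4}`. [folklore] -/
theorem lintegral_okRef_Phi_le {κ : ℝ} (hκ : 0 < κ) :
    ∫⁻ x, okRef.indicator (fun x => Phi κ x.imI (tvSq x)) x ≤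
      ENNReal.ofReal 2 * (ENNReal.ofReal 4 * (ENNReal.ofReal (512 / Real.sqrt (Real.sqrt κ)) * C1)) := by
  have e : (fun x : ℍ => okRef.indicator (fun x => Phi κ x.imI (tvSq x)) x) = fun x => HcoordK κ (coord4 x) := funext (indicator_Phi_eq_HcoordK κ)
  rw [e, lintegral_eq_lintegral_coord4 (HcoordK κ) (measurable_HcoordK κ), Measure.volume_eq_prod]
  simp only [HcoordK]
  rw [lintegral_prod _ (by
    exact (((measurable_const.indicator (measurableSet_lt (measurable_id.pow_const 2) measurable_const)).comp measurable_fst).mul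
      ((measurable_HinnerK κ).comp measurable_snd)).aemeasurable)]
  have hr : ∀ r : ℝ, ∫⁻ q : ℝ × (ℝ × ℝ), {r : ℝ | r ^ 2 < 1}.indicator 1 r *
      ({q : ℝ × ℝ | q.1 ^ 2 + q.2 ^ 2 ≤ 1}.indicator 1 q.2 * Phi κ q.1 (q.2.1 ^ 2 + q.2.2 ^ 2)) ≤
      (Ioo (-1 : ℝ) 1).indicator (fun _ => ENNReal.ofReal 4 * (ENNReal.ofReal (512 / Real.sqrt (Real.sqrt κ)) * C1)) r := by
    intro r
    rw [lintegral_const_mul _ (measurable_HinnerK κ)]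
    by_cases h : r ∈ {r : ℝ | r ^ 2 < 1}
    · have hab : |r| < 1 := (sq_lt_one_iff_abs_lt_one r).1 h
      have hI : r ∈ Ioo (-1 : ℝ) 1 := ⟨by linarith [(abs_lt.1 hab).1], (abs_lt.1 hab).2⟩
      rw [Set.indicator_of_mem h, Set.indicator_of_mem hI, Pi.one_apply, one_mul]
      exact lintegral_HinnerK_le hκ
    · rw [Set.indicator_of_notMem h, zero_mul]; exact zero_le
  calc _ ≤ ∫⁻ r : ℝ, (Ioo (-1 : ℝ) 1).indicator (fun _ => ENNReal.ofReal 4 * (ENNReal.ofReal (512 / Real.sqrt (Real.sqrt κ)) * C1)) r :=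
        lintegral_mono hr
    _ = _ := by
        rw [lintegral_indicator measurableSet_Ioo, setLIntegral_const, Real.volume_Ioo, show (1 : ℝ) - -1 = 2 by norm_num, mul_comm]

/-- ★★ **Decay of the `κ`-cut majorant**: `vol³(U_κ) ≤ 3·2·4·(512 C₁/κ^{1/4})` (`κ > 0`). [folklore] -/
theorem volume_domSetK_le_decay {κ : ℝ} (hκ : 0 < κ) :
    (((volume : Measure ℍ).prod (volume : Measure ℍ)).prod (volume : Measure ℍ)) (domSetK κ) ≤
      3 * (ENNReal.ofReal 2 * (ENNReal.ofReal 4 * (ENNReal.ofReal (512 / Real.sqrt (Real.sqrt κ)) * C1))) := by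
  have hR : (((volume : Measure ℍ).prod (volume : Measure ℍ)).prod (volume : Measure ℍ)) (domRefK κ) ≤
      ENNReal.ofReal 2 * (ENNReal.ofReal 4 * (ENNReal.ofReal (512 / Real.sqrt (Real.sqrt κ)) * C1)) := by
    refine (volume_domRefK_le_lintegral κ).trans ((lintegral_mono fun x => ?_).trans (lintegral_okRef_Phi_le hκ))
    by_cases hx : x ∈ okRef
    · rw [Set.indicator_of_mem hx, Set.indicator_of_mem hx]; exact volume_fibreK_sq_le_Phi hκ x
    · rw [Set.indicator_of_notMem hx, Set.indicator_of_notMem hx]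
  calc _ ≤ _ := volume_domSetK_le κ
    _ ≤ _ := by
        have e3 : ∀ A : ℝ≥0∞, A + A + A = 3 * A := fun A => by ring
        rw [e3]; gcongr

/-- The decay constant `C_dec = 3·2·4·512·C₁` (finite). [folklore] -/
def decayConst : ℝ≥0∞ := 3 * (ENNReal.ofReal 2 * (ENNReal.ofReal 4 * (ENNReal.ofReal 512 * C1)))

/-- `C_dec < ∞`. [folklore] -/
theorem decayConst_lt_top : decayConst < ⊤ := by
  unfold decayConst
  have h3 : (3 : ℝ≥0∞) < ⊤ := by simp
  exact ENNReal.mul_lt_top h3 (ENNReal.mul_lt_top ENNReal.ofReal_lt_top (ENNReal.mul_lt_top ENNReal.ofReal_lt_top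
    (ENNReal.mul_lt_top ENNReal.ofReal_lt_top C1_lt_top)))

/-- ★★★ **UNIFORM `κ^{-1/4}` DECAY OF THE TWO-SCALE FAMILY**: for all `η, ζ ≥ 0` and `κ > 0`,
`vol³(T(η, ζ, κ)) ≤ C_dec · (κ^{1/4})⁻¹` with `C_dec < ∞` independent of `η, ζ, κ` (`κ^{1/4} = √(√κ)`). [folklore] -/
theorem volume_twoScaleSet4_le_decay {η ζ κ : ℝ} (hη : 0 ≤ η) (hζ : 0 ≤ ζ) (hκ : 0 < κ) :
    (((volume : Measure ℍ).prod (volume : Measure ℍ)).prod (volume : Measure ℍ)) (twoScaleSet4 η ζ κ) ≤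
      decayConst * ENNReal.ofReal ((Real.sqrt (Real.sqrt κ))⁻¹) := by
  have hsk : 0 < Real.sqrt (Real.sqrt κ) := Real.sqrt_pos.2 (Real.sqrt_pos.2 hκ)
  refine (measure_mono (twoScaleSet4_subset_domSetK hη hζ hκ.le)).trans ((volume_domSetK_le_decay hκ).trans (le_of_eq ?_))
  unfold decayConst
  rw [div_eq_mul_inv, ENNReal.ofReal_mul (by norm_num : (0:ℝ) ≤ 512)]
  ring

/-- The same in existential form. [folklore] -/
theorem exists_volume_twoScaleSet4_le_decay :
    ∃ C : ℝ≥0∞, C < ⊤ ∧ ∀ η ζ κ : ℝ, 0 ≤ η → 0 ≤ ζ → 0 < κ →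
      (((volume : Measure ℍ).prod (volume : Measure ℍ)).prod (volume : Measure ℍ)) (twoScaleSet4 η ζ κ) ≤
        C * ENNReal.ofReal ((Real.sqrt (Real.sqrt κ))⁻¹) :=
  ⟨decayConst, decayConst_lt_top, fun _ _ _ hη hζ hκ => volume_twoScaleSet4_le_decay hη hζ hκ⟩

end Summit.QuantumFields.YangMills.Theorems.SwapVirialDeficit.ZeroModeGroup

end
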